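import Summits.BirchSwinnertonDyer.Rank1Residual.Additive.X3RankZeroCyclotomicThreeFacts
import Summits.BirchSwinnertonDyer.Rank1Residual.Additive.XSplitMultRankZeroCyclotomicThreeFacts
import Summits.BirchSwinnertonDyer.Rank1Residual.Additive.SubGordTwoReducible
import Summits.BirchSwinnertonDyer.Rank1Residual.AdditivePotMult.PStarTwistModel
import HarnessLib

/-!
# X3 at `p = 3`, CLASS LEVEL, ranks `(0,0)`: one statement for every Eisenstein additive pair `(W, 3)`
# whose twist `V = W^{(−3)}` is SEMISTABLE at `3` (cells (M) and (G-ord, `e = 2`) of the census)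

HONEST FRAMING (cell `b2b-bsdres`, run/shared/lean/b2b/bsd-rank1-residual/, verbatim in every
file): the goal of the cell is to DELETE the COMBINATION-SHAPED residual classes of the
Birch–Swinnerton-Dyer formula for ALL analytic-rank `≤ 1` elliptic curves over `ℚ` — "full BSD
formula for every rank `≤ 1` curve in class `C`" assembled STRICTLY from published theorems — so
that the rank-`≤ 1` remainder becomes exactly the CONSTRUCTION-SHAPED classes, which are TYPED
(missing-input `Prop`s), NOT attempted. This is not "finishing BSD". Seat additive-p4 (research route
on the construction-shaped classes X3/X4), gen 7; the X3 label is UNCHANGED by this file; nothing is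
booked here (the referee rules on bookings).

Theorems only (no `def`, no `sorry`, no new named fact). Lines V14 (twist good ordinary,
`X3RankZeroCyclotomicThreeFacts`), V15 (twist non-split multiplicative,
`XMultRankZeroCyclotomicThreeFacts`) and V16 (twist split multiplicative, exceptional zero,
`XSplitMultRankZeroCyclotomicThreeFacts`) each prove, over `K = ℚ(ζ₃)` and from NAMED published facts
only, `ord₃ #Ш(V) + ord₃ #Ш(W) ≤ ord₃ #Ш_an(V) + ord₃ #Ш_an(W)` for an additive `W ≅ V^{(−3)}` with the
binders `hord` / `hmult ∧ hns` / `hsplit`, `hred : ¬ Irr V 3`, `hadd : Addv W 3` supplied per row. This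
file states the union ONCE, at the level of the cell's EXACT class predicate
`ClassX3 W 3 = Red W 3 ∧ Addv W 3` (`Literature/…/Rank1Residual/Predicates.lean`), for the human's
partition table (`Partition.lean`, HOME/PARTITION.md): the only per-row data left are the twist
datum `C • V^{(−3)} = W` with `V` globally minimal and SEMISTABLE at `3` (`Good V 3 ∨ Mult V 3` — the
census cells (M) `v₃(j) < 0` and (G-ord, `e = 2`); on (M) the disjunct is a THEOREM of additive-p1,
`ClassX3M.mult_of_twist_model_negThree`, used in the `_of_potMult` corollaries), the two analytic ranks
and the two unit bits. Discharged inside: `Addv W 3` (from the class), `¬ Irr V 3` (twisting preserves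
reducibility, `AdditivePotMult.irr_iff_of_model_twist`), and — the one new observation — in the GOOD
case `V` is automatically ORDINARY at `3` (`goodOrd_twist_of_red`, additive-p2: a good supersingular
`V` would have irreducible `V[3]`, Serre 1972 §1.11 Prop. 12), so NO `hord` binder survives; the split /
non-split sub-case of a multiplicative `V` is decided internally (`by_cases`).

Named facts taken as hypotheses, all EXISTING Literature facts (registry A92, A97, A103–A106 and the
tree's `greenberg_stevens`, `Milne1972.bsdQuotient_baseChange_quadratic_anyModel`): each applies to one
branch only; a consumer at a row of known twist type may pass the irrelevant ones freely (they are
hypotheses, never evaluated).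

* `ClassX3.exists_padicVal_shaOrder_add_le_three_of_semistableTwist` — the sum inequality;
* `ClassX3.missingUpperBoundAt_three_of_semistableTwist` — `3 ∤ #Ш_an(V)` ⇒ `Typed.MissingUpperBoundAt W 3`;
* `ClassX3.bsdp_three_of_semistableTwist_of_shaAn_units` — doubly-unit rows ⇒ `BSD(W,3) ∧ BSD(V,3)`;
* `ClassX3M.…` — the (M)-cell versions with `Mult V 3` discharged (`AdditivePotMult.ClassX3M W 3`).

Census (hyp two-engine table `b2b-bsdres-hyp/hyp/cyc3/cyc3_two_engine.tsv`, `N < 2·10⁴`, engine A =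
ENGINE P3c row for row): X3 rank-`(0,0)` rows at `p = 3` with semistable twist: (G-ord) 79 + (M,
non-split) 20 + (M, split) 148 = 247 CORE-open rows, of which 78 + 19 + 146 = 243 doubly-unit.
-/

noncomputable section

open scoped Classical

open WeierstrassCurve Literature.NumberTheory.EllipticCurves
  Literature.NumberTheory.EllipticCurves.ModularForms
  Literature.NumberTheory.EllipticCurves.Rank1Residual
  Literature.NumberTheory.EllipticCurves.Rank1Residual.Typed
  Summit.BirchSwinnertonDyer.Rank1Residual.AdditivePotMult

namespace Summit.BirchSwinnertonDyer.Rank1Residual.Additive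

variable (V : WeierstrassCurve ℚ) [V.IsElliptic] [V.IsGloballyMinimal]
  (W : WeierstrassCurve ℚ) [W.IsElliptic] [W.IsGloballyMinimal]

omit [V.IsGloballyMinimal] [W.IsGloballyMinimal] in
/-- Twisting preserves reducibility of `E[3]`: for the X3 curve `W = C • V^{(−3)}` (`W[3]` reducible),
`V[3]` is reducible. [cite: SilvermanAEC2009, X.5 Cor. 5.4] -/
theorem red_twist_of_classX3 (hX : ClassX3 W 3) (C : VariableChange ℚ)
    (hC : C • V.quadraticTwist (-(3 : ℚ)) = W) : ¬ V.HasIrreducibleModPGaloisRep 3 :=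
  fun hirr ↦ hX.1 ((irr_iff_of_model_twist (W := V) (p := 3) (d := -(3 : ℚ)) (by norm_num)
    (Wd := W) ⟨C, hC⟩).mpr hirr)

omit [W.IsGloballyMinimal] in
/-- A GOOD twist of an X3 curve at `3` is good ORDINARY: `V[3]` is reducible with `W[3]`, and a good
supersingular curve has irreducible `3`-torsion (Serre 1972 §1.11 Prop. 12, tree
`goodOrd_twist_of_red`). [cite: Serre1972, §1.11 Prop. 12] -/
theorem isOrdinaryAt_twist_of_classX3_of_good (hX : ClassX3 W 3) (C : VariableChange ℚ)
    (hC : C • V.quadraticTwist (-(3 : ℚ)) = W) (hgood : V.HasGoodReductionAtPrime 3) :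
    IsOrdinaryAt V 3 := by
  have hredV : Red V 3 := red_twist_of_classX3 V W hX C hC
  obtain ⟨C₁, hC₁⟩ := V.exists_variableChange_quadraticTwist_one
  have h := goodOrd_twist_of_red V 3 (by norm_num) hredV (d := (1 : ℚ)) one_ne_zero V
    ⟨C₁⁻¹, by rw [← hC₁, inv_smul_smul]⟩ hgood
  exact ⟨h.1, h.2⟩

/-- **X3 at `p = 3`, class level, ranks `(0,0)`: the sum inequality.** Let `(W, 3)` be an X3 pair
(`ClassX3 W 3`: `W[3]` reducible, `W` additive at `3`, `W` globally minimal) and `V` a globally minimal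
curve with `C • V^{(−3)} = W` which is SEMISTABLE at `3` (`Good V 3 ∨ Mult V 3`), both of analytic rank
`0`. Then `#Ш_an(V) = q_V`, `#Ш_an(W) = q_W` are rationals with
**`ord₃ #Ш(V) + ord₃ #Ш(W) ≤ ord₃ q_V + ord₃ q_W`**, granted the named published facts of lines
V14/V15/V16: Wuthrich 2014 Thm. 16 over `ℚ(ζ₃)` in its three reduction flavours (`hW16`, `hW16ns`,
`hW16s`), Greenberg LNM 1716 Thm. 4.1 / pp. 112–113 over a number field (`hGr`, `hGrns`, `hGrs`),
Greenberg–Stevens for `V` (`hGS`, used only when `V` is split multiplicative at `3`), Milne 1972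
(`hMilne`), modularity (`hmod`, `hmodD`), Gross–Zagier–Kolyvagin (`hGZK`). Internally: good ⇒ ordinary
(`isOrdinaryAt_twist_of_classX3_of_good`), `¬ Irr V 3` (`red_twist_of_classX3`), and a `by_cases` on
split / non-split. [cite: Wuthrich2014, Thm. 16 (p. 397)] [cite: GreenbergLNM1716, Thm. 4.1 (p. 102) and §4 pp. 112–113]
[cite: Milne1972ArithmeticAV, §1 Thm. 1] -/
theorem ClassX3.exists_padicVal_shaOrder_add_le_three_of_semistableTwist
    (hW16 : Wuthrich2014.charIdeal_dvd_padicLFunction_cyclotomicThree)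
    (hW16ns : Wuthrich2014.thm16_charIdeal_dvd_nonsplitMultiplicative_cyclotomicThree)
    (hW16s : Wuthrich2014.thm16_charIdeal_dvd_splitMultiplicative_cyclotomicThree)
    (hGr : Greenberg1999.thm41_charValue_rankZero_numberField)
    (hGrns : Greenberg1999.thm41Analogue_charValue_rankZero_numberField)
    (hGrs : Greenberg1999.thm41Analogue_charValue_rankZero_split_baseChange)
    (hGS : greenberg_stevens V 3)
    (hMilne : Milne1972.bsdQuotient_baseChange_quadratic_anyModel)
    (hGZK : rank_eq_analyticRank_of_analyticRank_le_one) (hmod : hasEntireLFunction_rat)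
    (hmodD : nonempty_modularParametrizationData)
    (hX : ClassX3 W 3) (C : VariableChange ℚ) (hC : C • V.quadraticTwist (-(3 : ℚ)) = W)
    (hsst : V.HasGoodReductionAtPrime 3 ∨ V.HasMultiplicativeReductionAtPrime 3)
    (hrV : V.analyticRank = 0) (hrW : W.analyticRank = 0) :
    ∃ qV qW : ℚ, shaAn V = (qV : ℂ) ∧ shaAn W = (qW : ℂ) ∧
      (padicValNat 3 V.shaOrder : ℤ) + padicValNat 3 W.shaOrder ≤ padicValRat 3 qV + padicValRat 3 qW := by
  have hadd : Addv W 3 := hX.2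
  have hred : ¬ V.HasIrreducibleModPGaloisRep 3 := red_twist_of_classX3 V W hX C hC
  rcases hsst with hgood | hmult
  · exact X3CyclotomicThree.exists_padicVal_shaOrder_add_le_of_facts V W hW16 hGr hMilne hGZK hmod hmodD
      C hC (isOrdinaryAt_twist_of_classX3_of_good V W hX C hC hgood) hred hadd hrV hrW
  · by_cases hsplit : V.HasSplitMultiplicativeReductionAtPrime 3
    · exact XSplitMultCyclotomicThree.exists_padicVal_shaOrder_add_le_of_facts_of_red V W hW16s hGrs hGS
        hMilne hGZK hmod hmodD C hC hsplit hred hadd hrV hrW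
    · exact XMultCyclotomicThree.exists_padicVal_shaOrder_add_le_of_facts_of_red V W hW16ns hGrns hMilne
        hGZK hmod hmodD C hC hmult hsplit hred hadd hrV hrW

/-- **X3 at `p = 3`, class level: the cell's typed UPPER half for the additive curve.** In the
situation of `ClassX3.exists_padicVal_shaOrder_add_le_three_of_semistableTwist`, if `#Ш_an(V)` has
non-positive `3`-adic valuation (census bit `3 ∤ #Ш_an(V)` of the twist pair) then
`Typed.MissingUpperBoundAt W 3` (`ord₃ #Ш(W) ≤ ord₃ #Ш_an(W)`).
[cite: Wuthrich2014, Thm. 16 (p. 397)] [cite: GreenbergLNM1716, Thm. 4.1 (p. 102) and §4 pp. 112–113] -/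
theorem ClassX3.missingUpperBoundAt_three_of_semistableTwist
    (hW16 : Wuthrich2014.charIdeal_dvd_padicLFunction_cyclotomicThree)
    (hW16ns : Wuthrich2014.thm16_charIdeal_dvd_nonsplitMultiplicative_cyclotomicThree)
    (hW16s : Wuthrich2014.thm16_charIdeal_dvd_splitMultiplicative_cyclotomicThree)
    (hGr : Greenberg1999.thm41_charValue_rankZero_numberField)
    (hGrns : Greenberg1999.thm41Analogue_charValue_rankZero_numberField)
    (hGrs : Greenberg1999.thm41Analogue_charValue_rankZero_split_baseChange)
    (hGS : greenberg_stevens V 3)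
    (hMilne : Milne1972.bsdQuotient_baseChange_quadratic_anyModel)
    (hGZK : rank_eq_analyticRank_of_analyticRank_le_one) (hmod : hasEntireLFunction_rat)
    (hmodD : nonempty_modularParametrizationData)
    (hX : ClassX3 W 3) (C : VariableChange ℚ) (hC : C • V.quadraticTwist (-(3 : ℚ)) = W)
    (hsst : V.HasGoodReductionAtPrime 3 ∨ V.HasMultiplicativeReductionAtPrime 3)
    (hrV : V.analyticRank = 0) (hrW : W.analyticRank = 0)
    {qV : ℚ} (hqV : shaAn V = (qV : ℂ)) (hv : padicValRat 3 qV ≤ 0) :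
    MissingUpperBoundAt W 3 := by
  obtain ⟨qV', qW, hqV', hqW, hle⟩ := ClassX3.exists_padicVal_shaOrder_add_le_three_of_semistableTwist V W
    hW16 hW16ns hW16s hGr hGrns hGrs hGS hMilne hGZK hmod hmodD hX C hC hsst hrV hrW
  have hqq : qV' = qV := by exact_mod_cast hqV'.symm.trans hqV
  subst hqq
  refine ⟨qW, hqW, ?_⟩
  have h0 : (0 : ℤ) ≤ padicValNat 3 V.shaOrder := by positivity
  linarith

/-- **X3 at `p = 3`, class level: `BSD(W,3) ∧ BSD(V,3)` on the doubly-unit rank-`(0,0)` rows.** In the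
situation of `ClassX3.exists_padicVal_shaOrder_add_le_three_of_semistableTwist`, if `#Ш_an(V)` and
`#Ш_an(W)` are `3`-adic units then Miller's `BSD(W,3)` (the ADDITIVE X3 pair) and `BSD(V,3)` (its
semistable Eisenstein twist pair, an X1/X2-type pair) hold simultaneously. Census (hyp cyc3 two-engine,
`N < 2·10⁴`): 243 of the 247 CORE-open rank-`(0,0)` X3 rows at `p = 3` with semistable twist are
doubly-unit. Labels UNCHANGED; nothing booked by this theorem.
[cite: Wuthrich2014, Thm. 16 (p. 397)] [cite: GreenbergLNM1716, Thm. 4.1 (p. 102) and §4 pp. 112–113]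
[cite: Milne1972ArithmeticAV, §1 Thm. 1] [cite: Miller2011LMS, §1 and Def. 1.1] -/
theorem ClassX3.bsdp_three_of_semistableTwist_of_shaAn_units
    (hW16 : Wuthrich2014.charIdeal_dvd_padicLFunction_cyclotomicThree)
    (hW16ns : Wuthrich2014.thm16_charIdeal_dvd_nonsplitMultiplicative_cyclotomicThree)
    (hW16s : Wuthrich2014.thm16_charIdeal_dvd_splitMultiplicative_cyclotomicThree)
    (hGr : Greenberg1999.thm41_charValue_rankZero_numberField)
    (hGrns : Greenberg1999.thm41Analogue_charValue_rankZero_numberField)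
    (hGrs : Greenberg1999.thm41Analogue_charValue_rankZero_split_baseChange)
    (hGS : greenberg_stevens V 3)
    (hMilne : Milne1972.bsdQuotient_baseChange_quadratic_anyModel)
    (hGZK : rank_eq_analyticRank_of_analyticRank_le_one) (hmod : hasEntireLFunction_rat)
    (hmodD : nonempty_modularParametrizationData)
    (hX : ClassX3 W 3) (C : VariableChange ℚ) (hC : C • V.quadraticTwist (-(3 : ℚ)) = W)
    (hsst : V.HasGoodReductionAtPrime 3 ∨ V.HasMultiplicativeReductionAtPrime 3)
    (hrV : V.analyticRank = 0) (hrW : W.analyticRank = 0)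
    {qV qW : ℚ} (hqV : shaAn V = (qV : ℂ)) (hqW : shaAn W = (qW : ℂ))
    (hvV : padicValRat 3 qV = 0) (hvW : padicValRat 3 qW = 0) : BSDp W 3 ∧ BSDp V 3 := by
  obtain ⟨qV', qW', hqV', hqW', hle⟩ :=
    ClassX3.exists_padicVal_shaOrder_add_le_three_of_semistableTwist V W hW16 hW16ns hW16s hGr hGrns hGrs
      hGS hMilne hGZK hmod hmodD hX C hC hsst hrV hrW
  have hqq : qV' = qV := by exact_mod_cast hqV'.symm.trans hqV
  have hqq' : qW' = qW := by exact_mod_cast hqW'.symm.trans hqW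
  subst hqq hqq'
  rw [hvV, hvW, add_zero] at hle
  have hV0 : (0 : ℤ) ≤ padicValNat 3 V.shaOrder := by positivity
  have hW0 : (0 : ℤ) ≤ padicValNat 3 W.shaOrder := by positivity
  have huW : MissingUpperBoundAt W 3 := ⟨qW', hqW', by rw [hvW]; linarith⟩
  have huV : MissingUpperBoundAt V 3 := ⟨qV', hqV', by rw [hvV]; linarith⟩
  exact ⟨bsdp_of_missingPPartAt W 3 hGZK (by rw [hrW]; exact zero_le_one)
      (missingPPartAt_of_upper_of_shaAn_unit W 3 huW hqW' hvW),
    bsdp_of_missingPPartAt V 3 hGZK (by rw [hrV]; exact zero_le_one)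
      (missingPPartAt_of_upper_of_shaAn_unit V 3 huV hqV' hvV)⟩

/-! ### The (M)-cell: `Mult V 3` is a theorem of additive-p1 (`ClassX3M.mult_of_twist_model_negThree`) -/

/-- **X3♯(M) at `p = 3`, ranks `(0,0)`: the sum inequality with NO reduction datum on the twist.**
For `W` in additive-p1's class `ClassX3M W 3` (`ClassX3 W 3 ∧ v₃(j) < 0 ∧ 3 ≠ 2`) and ANY globally
minimal `V` with `C • V^{(−3)} = W`, both of analytic rank `0`:
`ord₃ #Ш(V) + ord₃ #Ш(W) ≤ ord₃ #Ш_an(V) + ord₃ #Ш_an(W)`, from the named facts of lines V15/V16 (the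
good-ordinary facts of V14 are not needed: `V` is multiplicative at `3`).
[cite: Wuthrich2014, Thm. 16 (p. 397)] [cite: GreenbergLNM1716, §4 pp. 112–113] [cite: SilvermanATAEC1994, V.5.3] -/
theorem ClassX3M.exists_padicVal_shaOrder_add_le_three
    (hW16ns : Wuthrich2014.thm16_charIdeal_dvd_nonsplitMultiplicative_cyclotomicThree)
    (hW16s : Wuthrich2014.thm16_charIdeal_dvd_splitMultiplicative_cyclotomicThree)
    (hGrns : Greenberg1999.thm41Analogue_charValue_rankZero_numberField)
    (hGrs : Greenberg1999.thm41Analogue_charValue_rankZero_split_baseChange)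
    (hGS : greenberg_stevens V 3)
    (hMilne : Milne1972.bsdQuotient_baseChange_quadratic_anyModel)
    (hGZK : rank_eq_analyticRank_of_analyticRank_le_one) (hmod : hasEntireLFunction_rat)
    (hmodD : nonempty_modularParametrizationData)
    (hX : ClassX3M W 3) (C : VariableChange ℚ) (hC : C • V.quadraticTwist (-(3 : ℚ)) = W)
    (hrV : V.analyticRank = 0) (hrW : W.analyticRank = 0) :
    ∃ qV qW : ℚ, shaAn V = (qV : ℂ) ∧ shaAn W = (qW : ℂ) ∧
      (padicValNat 3 V.shaOrder : ℤ) + padicValNat 3 W.shaOrder ≤ padicValRat 3 qV + padicValRat 3 qW := by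
  have hmult : V.HasMultiplicativeReductionAtPrime 3 := ClassX3M.mult_of_twist_model_negThree hX V C hC
  have hadd : Addv W 3 := hX.1.2
  have hred : ¬ V.HasIrreducibleModPGaloisRep 3 := red_twist_of_classX3 V W hX.1 C hC
  by_cases hsplit : V.HasSplitMultiplicativeReductionAtPrime 3
  · exact XSplitMultCyclotomicThree.exists_padicVal_shaOrder_add_le_of_facts_of_red V W hW16s hGrs hGS
      hMilne hGZK hmod hmodD C hC hsplit hred hadd hrV hrW
  · exact XMultCyclotomicThree.exists_padicVal_shaOrder_add_le_of_facts_of_red V W hW16ns hGrns hMilne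
      hGZK hmod hmodD C hC hmult hsplit hred hadd hrV hrW

/-- **X3♯(M) at `p = 3`: `BSD(W,3) ∧ BSD(V,3)` on the doubly-unit rank-`(0,0)` rows**, class-level form
of `XMultCyclotomicThree.…` / `XSplitMultCyclotomicThree.bsdp_of_shaAn_units_of_facts_of_red` with the
multiplicativity of the twist discharged. Census (hyp cyc3, `N < 2·10⁴`): 165 of the 168 CORE-open
rank-`(0,0)` X3 ∧ (M) rows at `p = 3`. Labels UNCHANGED; nothing booked.
[cite: Wuthrich2014, Thm. 16 (p. 397)] [cite: GreenbergLNM1716, §4 pp. 112–113] [cite: Miller2011LMS, §1 and Def. 1.1] -/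
theorem ClassX3M.bsdp_three_of_shaAn_units
    (hW16ns : Wuthrich2014.thm16_charIdeal_dvd_nonsplitMultiplicative_cyclotomicThree)
    (hW16s : Wuthrich2014.thm16_charIdeal_dvd_splitMultiplicative_cyclotomicThree)
    (hGrns : Greenberg1999.thm41Analogue_charValue_rankZero_numberField)
    (hGrs : Greenberg1999.thm41Analogue_charValue_rankZero_split_baseChange)
    (hGS : greenberg_stevens V 3)
    (hMilne : Milne1972.bsdQuotient_baseChange_quadratic_anyModel)
    (hGZK : rank_eq_analyticRank_of_analyticRank_le_one) (hmod : hasEntireLFunction_rat)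
    (hmodD : nonempty_modularParametrizationData)
    (hX : ClassX3M W 3) (C : VariableChange ℚ) (hC : C • V.quadraticTwist (-(3 : ℚ)) = W)
    (hrV : V.analyticRank = 0) (hrW : W.analyticRank = 0)
    {qV qW : ℚ} (hqV : shaAn V = (qV : ℂ)) (hqW : shaAn W = (qW : ℂ))
    (hvV : padicValRat 3 qV = 0) (hvW : padicValRat 3 qW = 0) : BSDp W 3 ∧ BSDp V 3 := by
  obtain ⟨qV', qW', hqV', hqW', hle⟩ :=
    ClassX3M.exists_padicVal_shaOrder_add_le_three V W hW16ns hW16s hGrns hGrs hGS hMilne hGZK hmod hmodD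
      hX C hC hrV hrW
  have hqq : qV' = qV := by exact_mod_cast hqV'.symm.trans hqV
  have hqq' : qW' = qW := by exact_mod_cast hqW'.symm.trans hqW
  subst hqq hqq'
  rw [hvV, hvW, add_zero] at hle
  have hV0 : (0 : ℤ) ≤ padicValNat 3 V.shaOrder := by positivity
  have hW0 : (0 : ℤ) ≤ padicValNat 3 W.shaOrder := by positivity
  have huW : MissingUpperBoundAt W 3 := ⟨qW', hqW', by rw [hvW]; linarith⟩
  have huV : MissingUpperBoundAt V 3 := ⟨qV', hqV', by rw [hvV]; linarith⟩
  exact ⟨bsdp_of_missingPPartAt W 3 hGZK (by rw [hrW]; exact zero_le_one)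
      (missingPPartAt_of_upper_of_shaAn_unit W 3 huW hqW' hvW),
    bsdp_of_missingPPartAt V 3 hGZK (by rw [hrV]; exact zero_le_one)
      (missingPPartAt_of_upper_of_shaAn_unit V 3 huV hqV' hvV)⟩

end Summit.BirchSwinnertonDyer.Rank1Residual.Additive

end
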